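import Literature.NumberTheory.DiophantineGeometry.LocalReductionProofs
import Literature.NumberTheory.Automorphic.GaloisActionPlaces
import HarnessLib

/-!
# The reduction type of a Galois-conjugate Weierstrass curve at the conjugate place

`Proofs` file (theorems only; no definitions, no named facts, no instances) in topic
`NumberTheory/EllipticCurves`. Classical transport-of-structure statements around Silverman,
*AEC* VII.1 / VII.5, written for the cell `abc-iut` (block E, [J-III] Lemma 3.2.1: the reduction type
of an elliptic curve over a Galois extension `E/F` whose isomorphism class is `Gal(E/F)`-stable is
CONSTANT on the places of `E` above a place of `F`), but stated in general:

* §1 `WeierstrassCurve.isIntegral_map_iff_of_valuation_eq`, `isMinimal_map_iff_of_valuation_eq`,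
  `hasGoodReduction_map_iff_of_valuation_eq`, `hasMultiplicativeReduction_map_iff_of_valuation_eq`,
  `hasAdditiveReduction_map_iff_of_valuation_eq` — Mathlib's predicates `IsIntegral R`, `IsMinimal R`,
  `HasGoodReduction R`, `HasMultiplicativeReduction R`, `HasAdditiveReduction R` (for a DVR `R` with
  fraction field `K`) are transported along a field isomorphism `e : K₁ ≃+* K₂` carrying a valuation
  `V₁` with valuation ring `R₁` to a valuation `V₂` with valuation ring `R₂` (`V₂ (e x) = V₁ x`):
  every notion in Silverman *AEC* VII.1 (integral / minimal equation, `v(Δ)`, `v(c₄)`) only depends on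
  the valued field `(K, v)`.
* §2 For a number field `E`, `σ ∈ Aut(E/F)` and a finite place `w` of `E`: the conjugate equation
  `W^σ = W.map σ` has at the conjugate place `σ • w` (the tree's action
  `Literature.NumberTheory.Automorphic.instMulActionHeightOneSpectrum`) the reduction type of `W` at `w` —
  `hasGoodReductionAt_map_algEquiv_smul_iff`, `hasMultiplicativeReductionAt_map_algEquiv_smul_iff`,
  `hasAdditiveReductionAt_map_algEquiv_smul_iff` (Cassels–Fröhlich VII §1.1: `σ` induces an isomorphism
  of valued fields `E_w ≃ E_{σ w}`, the tree's `galAdicCompletionEquiv`; §1 is applied to it and the two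
  chosen minimal models are compared by Silverman *AEC* VII.1.3 (b), the tree's
  `hasMultiplicativeReduction_iff_of_isMinimal_of_eq_smul`).
* §3 If the `E`-isomorphism class of an elliptic curve `W/E` is stable under `σ` (`C • W = W^σ` for a
  change of variables `C` over `E`) then `W` has the same reduction type at `w` and `σ • w`
  (`has…ReductionAt_algEquiv_smul_iff_of_smul_eq_map`); if this holds for every `σ ∈ Gal(E/F)` with `E/F`
  Galois, the reduction type of `W` is the same at any two places of `E` over one place of `F`
  (`has…ReductionAt_iff_of_under_eq`, transitivity of `Gal(E/F)` on the fibres, Cassels–Fröhlich VII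
  Prop. 1.2 (ii), the tree's `exists_algEquiv_smul_eq`).

Inputs: Mathlib and LANDED tree theorems only (`LocalReduction*`, `GaloisActionPlaces`). No `sorry`.

## References
* [SilvermanAEC2009] J. H. Silverman, *The Arithmetic of Elliptic Curves*, 2nd ed., GTM 106 (2009),
  VII.1 (minimal equations, Prop. 1.3 (b)), VII.5 Prop. 5.1 (reduction types).
* [CasselsFrohlichANT1967] J. W. S. Cassels, A. Fröhlich (eds.), *Algebraic Number Theory* (1967),
  Ch. VII (J. Tate), §1.1 and Prop. 1.2 (ii).
-/

noncomputable section

open IsDedekindDomain NumberField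

namespace WeierstrassCurve

/-! ## §1 Transport of the reduction predicates along a valuation-preserving field isomorphism -/

section Transport

variable {R₁ : Type*} [CommRing R₁] [IsDomain R₁] [IsDiscreteValuationRing R₁]
  {K₁ : Type*} [Field K₁] [Algebra R₁ K₁] [IsFractionRing R₁ K₁]
  {R₂ : Type*} [CommRing R₂] [IsDomain R₂] [IsDiscreteValuationRing R₂]
  {K₂ : Type*} [Field K₂] [Algebra R₂ K₂] [IsFractionRing R₂ K₂]
  {Γ : Type*} [LinearOrderedCommGroupWithZero Γ] {V₁ : Valuation K₁ Γ} {V₂ : Valuation K₂ Γ}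
  (hV₁ : ∀ x : K₁, V₁ x ≤ 1 ↔ x ∈ (algebraMap R₁ K₁).range)
  (hV₂ : ∀ x : K₂, V₂ x ≤ 1 ↔ x ∈ (algebraMap R₂ K₂).range)
  (e : K₁ ≃+* K₂) (he : ∀ x : K₁, V₂ (e x) = V₁ x)

/-- A change of variables over `K₂` is the image along `e : K₁ ≃+* K₂` of one over `K₁`. [folklore] -/
private theorem VariableChange.exists_eq_map_ringEquiv (C : VariableChange K₂) :
    ∃ C₁ : VariableChange K₁, C = C₁.map (e : K₁ →+* K₂) :=
  ⟨C.map (e.symm : K₂ →+* K₁), by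
    have hid : (e : K₁ →+* K₂).comp (e.symm : K₂ →+* K₁) = RingHom.id K₂ := by
      ext x; simp
    rw [VariableChange.map_map, hid, VariableChange.map_id]⟩

omit [IsDomain R₁] [IsDiscreteValuationRing R₁] [IsFractionRing R₁ K₁] [IsDomain R₂] [IsDiscreteValuationRing R₂]
  [IsFractionRing R₂ K₂] in
include hV₁ hV₂ he in
/-- **Integrality transports**: `W^e` is `R₂`-integral iff `W` is `R₁`-integral, when `e : K₁ ≃+* K₂`
carries the valuation `V₁` (valuation ring `R₁`) to `V₂` (valuation ring `R₂`) — the coefficients of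
`W^e` are the `e aᵢ` and `V₂ (e aᵢ) ≤ 1 ↔ V₁ aᵢ ≤ 1` (Silverman *AEC* VII.1: Weierstrass equations with
`v`-integral coefficients). [cite: SilvermanAEC2009, VII.1 (integral Weierstrass equations, PDF p. 186)] -/
theorem isIntegral_map_iff_of_valuation_eq (W : WeierstrassCurve K₁) :
    (W.map (e : K₁ →+* K₂)).IsIntegral R₂ ↔ W.IsIntegral R₁ := by
  rw [isIntegral_iff_forall_mem_range (R := R₂), isIntegral_iff_forall_mem_range (R := R₁)]
  simp only [map_a₁, map_a₂, map_a₃, map_a₄, map_a₆, RingEquiv.coe_toRingHom, ← hV₁, ← hV₂, he]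

include hV₁ hV₂ he in
/-- **Minimality transports**: `W^e` is a minimal equation over `R₂` iff `W` is one over `R₁`
(minimality only involves integrality of the `K`-isomorphic equations and the valuations of their
discriminants, Silverman *AEC* VII.1, Definition p. 186; both are preserved by `e`, every change of
variables over `K₂` being the image of one over `K₁`). [cite: SilvermanAEC2009, VII.1 (definition of a minimal equation)] -/
theorem isMinimal_map_iff_of_valuation_eq (W : WeierstrassCurve K₁) :
    (W.map (e : K₁ →+* K₂)).IsMinimal R₂ ↔ W.IsMinimal R₁ := by
  rw [isMinimal_iff_of_le_one_iff hV₂, isMinimal_iff_of_le_one_iff hV₁,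
    isIntegral_map_iff_of_valuation_eq hV₁ hV₂ e he]
  refine and_congr_right fun _ => ⟨fun H C hC => ?_, fun H C hC => ?_⟩
  · have h := H (C.map (e : K₁ →+* K₂))
      (by rw [map_variableChange, isIntegral_map_iff_of_valuation_eq hV₁ hV₂ e he]; exact hC)
    rwa [map_variableChange, map_Δ, map_Δ, RingEquiv.coe_toRingHom, he, he] at h
  · obtain ⟨C₁, rfl⟩ := VariableChange.exists_eq_map_ringEquiv e C
    rw [map_variableChange, isIntegral_map_iff_of_valuation_eq hV₁ hV₂ e he] at hC
    have h := H C₁ hC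
    rwa [map_variableChange, map_Δ, map_Δ, RingEquiv.coe_toRingHom, he, he]

include hV₁ hV₂ he in
/-- The normalised valuations of the two DVRs compare through `e`: `v₂ (e x) < 1 ↔ v₁ x < 1` (each
`vᵢ` is equivalent to `Vᵢ`, having the same valuation ring). [folklore] -/
private theorem valuation_maximalIdeal_map_lt_one_iff_of_valuation_eq (x : K₁) :
    (IsDiscreteValuationRing.maximalIdeal R₂).valuation K₂ (e x) < 1 ↔
      (IsDiscreteValuationRing.maximalIdeal R₁).valuation K₁ x < 1 := by
  rw [(isEquiv_valuation_maximalIdeal_of_le_one_iff hV₂).lt_one_iff_lt_one,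
    (isEquiv_valuation_maximalIdeal_of_le_one_iff hV₁).lt_one_iff_lt_one, he]

include hV₁ hV₂ he in
/-- The normalised valuations of the two DVRs compare through `e`: `v₂ (e x) = 1 ↔ v₁ x = 1`. [folklore] -/
private theorem valuation_maximalIdeal_map_eq_one_iff_of_valuation_eq (x : K₁) :
    (IsDiscreteValuationRing.maximalIdeal R₂).valuation K₂ (e x) = 1 ↔
      (IsDiscreteValuationRing.maximalIdeal R₁).valuation K₁ x = 1 := by
  rw [(isEquiv_valuation_maximalIdeal_of_le_one_iff hV₂).eq_one_iff_eq_one,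
    (isEquiv_valuation_maximalIdeal_of_le_one_iff hV₁).eq_one_iff_eq_one, he]

include hV₁ hV₂ he in
/-- **Good reduction transports** along a valuation-preserving field isomorphism (minimal equation with
unit discriminant, Silverman *AEC* VII.5 Prop. 5.1 (a)). [cite: SilvermanAEC2009, VII.5 Prop. 5.1(a)] -/
theorem hasGoodReduction_map_iff_of_valuation_eq (W : WeierstrassCurve K₁) :
    (W.map (e : K₁ →+* K₂)).HasGoodReduction R₂ ↔ W.HasGoodReduction R₁ := by
  rw [hasGoodReduction_iff, hasGoodReduction_iff, isMinimal_map_iff_of_valuation_eq hV₁ hV₂ e he, map_Δ,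
    RingEquiv.coe_toRingHom, valuation_maximalIdeal_map_eq_one_iff_of_valuation_eq hV₁ hV₂ e he]

include hV₁ hV₂ he in
/-- **Multiplicative reduction transports** along a valuation-preserving field isomorphism (minimal
equation with `v(Δ) > 0`, `v(c₄) = 0`, Silverman *AEC* VII.5 Prop. 5.1 (b)). [cite: SilvermanAEC2009, VII.5 Prop. 5.1(b)] -/
theorem hasMultiplicativeReduction_map_iff_of_valuation_eq (W : WeierstrassCurve K₁) :
    (W.map (e : K₁ →+* K₂)).HasMultiplicativeReduction R₂ ↔ W.HasMultiplicativeReduction R₁ := by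
  rw [hasMultiplicativeReduction_iff, hasMultiplicativeReduction_iff,
    isMinimal_map_iff_of_valuation_eq hV₁ hV₂ e he, map_Δ, map_c₄, RingEquiv.coe_toRingHom,
    valuation_maximalIdeal_map_lt_one_iff_of_valuation_eq hV₁ hV₂ e he,
    valuation_maximalIdeal_map_eq_one_iff_of_valuation_eq hV₁ hV₂ e he]

include hV₁ hV₂ he in
/-- **Additive reduction transports** along a valuation-preserving field isomorphism (minimal equation
with `v(Δ) > 0`, `v(c₄) > 0`, Silverman *AEC* VII.5 Prop. 5.1 (c)). [cite: SilvermanAEC2009, VII.5 Prop. 5.1(c)] -/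
theorem hasAdditiveReduction_map_iff_of_valuation_eq (W : WeierstrassCurve K₁) :
    (W.map (e : K₁ →+* K₂)).HasAdditiveReduction R₂ ↔ W.HasAdditiveReduction R₁ := by
  rw [hasAdditiveReduction_iff, hasAdditiveReduction_iff,
    isMinimal_map_iff_of_valuation_eq hV₁ hV₂ e he, map_Δ, map_c₄, RingEquiv.coe_toRingHom,
    valuation_maximalIdeal_map_lt_one_iff_of_valuation_eq hV₁ hV₂ e he,
    valuation_maximalIdeal_map_lt_one_iff_of_valuation_eq hV₁ hV₂ e he]

end Transport

/-! ## §2 Number fields: the conjugate equation `W^σ` at the conjugate place `σ • w` -/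

section NumberField

open Literature.NumberTheory.Automorphic

variable {F : Type*} [Field F] {E : Type*} [Field E] [NumberField E] [Algebra F E]
  (σ : E ≃ₐ[F] E) (w : HeightOneSpectrum (𝓞 E)) (W : WeierstrassCurve E)

/-- The base change of the conjugate equation `W^σ` to `E_{σ w}` is the image of `W ⊗ E_w` along the
isomorphism of valued fields `σ_w : E_w ≃ E_{σ w}` induced by `σ` (Cassels–Fröhlich VII §1.1; the tree's
`galAdicCompletionEquiv`, which extends `σ`). [cite: CasselsFrohlichANT1967, Ch. VII §1.1] -/
theorem baseChange_map_algEquiv_eq_map_galAdicCompletionEquiv :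
    (W.map (σ : E →+* E)).baseChange ((σ • w).adicCompletion E) =
      (W.baseChange (w.adicCompletion E)).map
        (galAdicCompletionEquiv (L := E) σ (rfl : σ • w = σ • w) :
          w.adicCompletion E →+* (σ • w).adicCompletion E) := by
  simp only [baseChange, map_map]
  congr 1
  refine RingHom.ext fun x => ?_
  exact (galAdicCompletionMap_coe_algEquiv F σ (rfl : σ • w = σ • w) x).symm

/-- The chosen local minimal model of an elliptic curve is an elliptic curve; its discriminant is
non-zero after any further base change. [folklore] -/
private theorem map_localMinimalModel_Δ_ne_zero [W.IsElliptic] {S : Type*} [Field S]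
    (f : w.adicCompletion E →+* S) : ((W.localMinimalModel w).map f).Δ ≠ 0 := by
  haveI := isElliptic_localMinimalModel w W
  rw [map_Δ]
  exact (map_ne_zero f).mpr (W.localMinimalModel w).isUnit_Δ.ne_zero

/-- **The conjugate equation has good reduction at the conjugate place iff the equation has good
reduction**: for `σ ∈ Aut(E/F)`, `W^σ` has good reduction at `σ • w` iff `W` has good reduction at `w`
(`σ` induces an isomorphism of valued fields `E_w ≃ E_{σ w}` carrying a minimal model of `W ⊗ E_w` to a
minimal model of `W^σ ⊗ E_{σ w}` with the same `v(Δ)`, `v(c₄)`; Silverman *AEC* VII.1.3 (b), VII.5.1).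
[cite: SilvermanAEC2009, VII.5 Prop. 5.1 and VII.1 Prop. 1.3(b)] -/
theorem hasGoodReductionAt_map_algEquiv_smul_iff [W.IsElliptic] :
    (W.map (σ : E →+* E)).HasGoodReductionAt (σ • w) ↔ W.HasGoodReductionAt w := by
  have he : ∀ y, Valued.v (galAdicCompletionEquiv (L := E) σ (rfl : σ • w = σ • w) y) = Valued.v y :=
    fun y => valued_galAdicCompletionMap E σ rfl y
  have hV₁ := valued_le_one_iff_mem_range_adicCompletionIntegers (K := E) w
  have hV₂ := valued_le_one_iff_mem_range_adicCompletionIntegers (K := E) (σ • w)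
  obtain ⟨C₁, hC₁⟩ : ∃ C₁ : VariableChange (w.adicCompletion E),
      W.localMinimalModel w = C₁ • W.baseChange (w.adicCompletion E) := ⟨_, rfl⟩
  obtain ⟨C₂, hC₂⟩ : ∃ C₂ : VariableChange ((σ • w).adicCompletion E),
      (W.map (σ : E →+* E)).localMinimalModel (σ • w) =
        C₂ • (W.map (σ : E →+* E)).baseChange ((σ • w).adicCompletion E) := ⟨_, rfl⟩
  haveI hMmin : ((W.localMinimalModel w).map
      (galAdicCompletionEquiv (L := E) σ (rfl : σ • w = σ • w) :
        w.adicCompletion E →+* (σ • w).adicCompletion E)).IsMinimal ((σ • w).adicCompletionIntegers E) :=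
    (isMinimal_map_iff_of_valuation_eq hV₁ hV₂ _ he _).mpr inferInstance
  have hrel : (W.map (σ : E →+* E)).localMinimalModel (σ • w) =
      (C₂ * (C₁.map (galAdicCompletionEquiv (L := E) σ (rfl : σ • w = σ • w) :
        w.adicCompletion E →+* (σ • w).adicCompletion E))⁻¹) •
        (W.localMinimalModel w).map
          (galAdicCompletionEquiv (L := E) σ (rfl : σ • w = σ • w) :
            w.adicCompletion E →+* (σ • w).adicCompletion E) := by
    rw [hC₂, hC₁, ← map_variableChange, ← baseChange_map_algEquiv_eq_map_galAdicCompletionEquiv,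
      mul_smul, inv_smul_smul]
  unfold HasGoodReductionAt
  have key := hasGoodReduction_map_iff_of_valuation_eq hV₁ hV₂ _ he (W.localMinimalModel w)
  rw [hasGoodReduction_iff, hasGoodReduction_iff] at key ⊢
  rw [valuation_Δ_eq_of_isMinimal_of_eq_smul ((σ • w).adicCompletionIntegers E) hrel]
  have h1 : ((W.map (σ : E →+* E)).localMinimalModel (σ • w)).IsMinimal
      ((σ • w).adicCompletionIntegers E) := inferInstance
  have h2 : (W.localMinimalModel w).IsMinimal (w.adicCompletionIntegers E) := inferInstance
  simp only [hMmin, h1, h2, true_and] at key ⊢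
  exact key

/-- **The conjugate equation has multiplicative reduction at the conjugate place iff the equation has
multiplicative reduction** (`σ ∈ Aut(E/F)`, elliptic `W/E`): transport along `E_w ≃ E_{σ w}` and
Silverman *AEC* VII.1.3 (b) / VII.5.1 (b). [cite: SilvermanAEC2009, VII.5 Prop. 5.1(b) and VII.1 Prop. 1.3(b)] -/
theorem hasMultiplicativeReductionAt_map_algEquiv_smul_iff [W.IsElliptic] :
    (W.map (σ : E →+* E)).HasMultiplicativeReductionAt (σ • w) ↔ W.HasMultiplicativeReductionAt w := by
  have he : ∀ y, Valued.v (galAdicCompletionEquiv (L := E) σ (rfl : σ • w = σ • w) y) = Valued.v y :=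
    fun y => valued_galAdicCompletionMap E σ rfl y
  have hV₁ := valued_le_one_iff_mem_range_adicCompletionIntegers (K := E) w
  have hV₂ := valued_le_one_iff_mem_range_adicCompletionIntegers (K := E) (σ • w)
  obtain ⟨C₁, hC₁⟩ : ∃ C₁ : VariableChange (w.adicCompletion E),
      W.localMinimalModel w = C₁ • W.baseChange (w.adicCompletion E) := ⟨_, rfl⟩
  obtain ⟨C₂, hC₂⟩ : ∃ C₂ : VariableChange ((σ • w).adicCompletion E),
      (W.map (σ : E →+* E)).localMinimalModel (σ • w) =
        C₂ • (W.map (σ : E →+* E)).baseChange ((σ • w).adicCompletion E) := ⟨_, rfl⟩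
  haveI hMmin : ((W.localMinimalModel w).map
      (galAdicCompletionEquiv (L := E) σ (rfl : σ • w = σ • w) :
        w.adicCompletion E →+* (σ • w).adicCompletion E)).IsMinimal ((σ • w).adicCompletionIntegers E) :=
    (isMinimal_map_iff_of_valuation_eq hV₁ hV₂ _ he _).mpr inferInstance
  have hrel : (W.map (σ : E →+* E)).localMinimalModel (σ • w) =
      (C₂ * (C₁.map (galAdicCompletionEquiv (L := E) σ (rfl : σ • w = σ • w) :
        w.adicCompletion E →+* (σ • w).adicCompletion E))⁻¹) •
        (W.localMinimalModel w).map
          (galAdicCompletionEquiv (L := E) σ (rfl : σ • w = σ • w) :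
            w.adicCompletion E →+* (σ • w).adicCompletion E) := by
    rw [hC₂, hC₁, ← map_variableChange, ← baseChange_map_algEquiv_eq_map_galAdicCompletionEquiv,
      mul_smul, inv_smul_smul]
  unfold HasMultiplicativeReductionAt
  rw [hasMultiplicativeReduction_iff_of_isMinimal_of_eq_smul ((σ • w).adicCompletionIntegers E) hrel
      (map_localMinimalModel_Δ_ne_zero w W _),
    hasMultiplicativeReduction_map_iff_of_valuation_eq hV₁ hV₂ _ he]

/-- **The conjugate equation has additive reduction at the conjugate place iff the equation has additive
reduction** (`σ ∈ Aut(E/F)`, elliptic `W/E`): transport along `E_w ≃ E_{σ w}` and Silverman *AEC*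
VII.1.3 (b) / VII.5.1 (c). [cite: SilvermanAEC2009, VII.5 Prop. 5.1(c) and VII.1 Prop. 1.3(b)] -/
theorem hasAdditiveReductionAt_map_algEquiv_smul_iff [W.IsElliptic] :
    (W.map (σ : E →+* E)).HasAdditiveReductionAt (σ • w) ↔ W.HasAdditiveReductionAt w := by
  have he : ∀ y, Valued.v (galAdicCompletionEquiv (L := E) σ (rfl : σ • w = σ • w) y) = Valued.v y :=
    fun y => valued_galAdicCompletionMap E σ rfl y
  have hV₁ := valued_le_one_iff_mem_range_adicCompletionIntegers (K := E) w
  have hV₂ := valued_le_one_iff_mem_range_adicCompletionIntegers (K := E) (σ • w)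
  obtain ⟨C₁, hC₁⟩ : ∃ C₁ : VariableChange (w.adicCompletion E),
      W.localMinimalModel w = C₁ • W.baseChange (w.adicCompletion E) := ⟨_, rfl⟩
  obtain ⟨C₂, hC₂⟩ : ∃ C₂ : VariableChange ((σ • w).adicCompletion E),
      (W.map (σ : E →+* E)).localMinimalModel (σ • w) =
        C₂ • (W.map (σ : E →+* E)).baseChange ((σ • w).adicCompletion E) := ⟨_, rfl⟩
  haveI hMmin : ((W.localMinimalModel w).map
      (galAdicCompletionEquiv (L := E) σ (rfl : σ • w = σ • w) :
        w.adicCompletion E →+* (σ • w).adicCompletion E)).IsMinimal ((σ • w).adicCompletionIntegers E) :=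
    (isMinimal_map_iff_of_valuation_eq hV₁ hV₂ _ he _).mpr inferInstance
  have hrel : (W.map (σ : E →+* E)).localMinimalModel (σ • w) =
      (C₂ * (C₁.map (galAdicCompletionEquiv (L := E) σ (rfl : σ • w = σ • w) :
        w.adicCompletion E →+* (σ • w).adicCompletion E))⁻¹) •
        (W.localMinimalModel w).map
          (galAdicCompletionEquiv (L := E) σ (rfl : σ • w = σ • w) :
            w.adicCompletion E →+* (σ • w).adicCompletion E) := by
    rw [hC₂, hC₁, ← map_variableChange, ← baseChange_map_algEquiv_eq_map_galAdicCompletionEquiv,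
      mul_smul, inv_smul_smul]
  unfold HasAdditiveReductionAt
  rw [hasAdditiveReduction_iff_of_isMinimal_of_eq_smul ((σ • w).adicCompletionIntegers E) hrel
      (map_localMinimalModel_Δ_ne_zero w W _),
    hasAdditiveReduction_map_iff_of_valuation_eq hV₁ hV₂ _ he]

/-! ## §3 Curves whose isomorphism class is `σ`-stable; constancy on the fibres of `V(E) → V(F)` -/

/-- If `W ≅_E W^σ` (`C • W = W^σ` over `E`), then `W` has good reduction at `σ • w` iff at `w` (§2 and
the isomorphism invariance of the reduction type, Silverman *AEC* VII.5.1 / VII.1.3 (b), the tree's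
`hasGoodReductionAt_smul_iff_holds`). [cite: SilvermanAEC2009, VII.5 Prop. 5.1 and VII.1 Prop. 1.3(b)] -/
theorem hasGoodReductionAt_algEquiv_smul_iff_of_smul_eq_map [W.IsElliptic] {C : VariableChange E}
    (hC : C • W = W.map (σ : E →+* E)) :
    W.HasGoodReductionAt (σ • w) ↔ W.HasGoodReductionAt w := by
  rw [← hasGoodReductionAt_map_algEquiv_smul_iff σ w W, ← hC]
  exact (hasGoodReductionAt_smul_iff_holds (σ • w) W C).symm

/-- If `W ≅_E W^σ`, then `W` has multiplicative reduction at `σ • w` iff at `w`.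
[cite: SilvermanAEC2009, VII.5 Prop. 5.1(b) and VII.1 Prop. 1.3(b)] -/
theorem hasMultiplicativeReductionAt_algEquiv_smul_iff_of_smul_eq_map [W.IsElliptic] {C : VariableChange E}
    (hC : C • W = W.map (σ : E →+* E)) :
    W.HasMultiplicativeReductionAt (σ • w) ↔ W.HasMultiplicativeReductionAt w := by
  rw [← hasMultiplicativeReductionAt_map_algEquiv_smul_iff σ w W, ← hC]
  have h := hasMultiplicativeReductionAt_smul_iff_holds (σ • w) W
  exact (h C).symm

/-- If `W ≅_E W^σ`, then `W` has additive reduction at `σ • w` iff at `w`.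
[cite: SilvermanAEC2009, VII.5 Prop. 5.1(c) and VII.1 Prop. 1.3(b)] -/
theorem hasAdditiveReductionAt_algEquiv_smul_iff_of_smul_eq_map [W.IsElliptic] {C : VariableChange E}
    (hC : C • W = W.map (σ : E →+* E)) :
    W.HasAdditiveReductionAt (σ • w) ↔ W.HasAdditiveReductionAt w := by
  rw [← hasAdditiveReductionAt_map_algEquiv_smul_iff σ w W, ← hC]
  have h := hasAdditiveReductionAt_smul_iff_holds (σ • w) W
  exact (h C).symm

variable {w}

/-- **Constancy on fibres, good reduction.** If `E/F` is a Galois extension of number fields and the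
`E`-isomorphism class of the elliptic curve `W/E` is `Gal(E/F)`-stable (`W ≅_E W^σ` for every `σ`), then
`W` has good reduction at one place of `E` above a place `u` of `F` iff at every place above `u`
(`Gal(E/F)` permutes these places transitively, Cassels–Fröhlich VII Prop. 1.2 (ii)).
[cite: CasselsFrohlichANT1967, Ch. VII Prop. 1.2 (ii)] [cite: SilvermanAEC2009, VII.5 Prop. 5.1] -/
theorem hasGoodReductionAt_iff_of_under_eq [NumberField F] [IsGalois F E] [W.IsElliptic]
    (hW : ∀ σ : E ≃ₐ[F] E, ∃ C : VariableChange E, C • W = W.map (σ : E →+* E))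
    {w w' : HeightOneSpectrum (𝓞 E)} (h : w.under (𝓞 F) = w'.under (𝓞 F)) :
    W.HasGoodReductionAt w ↔ W.HasGoodReductionAt w' := by
  obtain ⟨σ, rfl⟩ := HeightOneSpectrum.exists_algEquiv_smul_eq F h
  obtain ⟨C, hC⟩ := hW σ
  exact (hasGoodReductionAt_algEquiv_smul_iff_of_smul_eq_map σ w W hC).symm

/-- **Constancy on fibres, multiplicative reduction** (same hypotheses).
[cite: CasselsFrohlichANT1967, Ch. VII Prop. 1.2 (ii)] [cite: SilvermanAEC2009, VII.5 Prop. 5.1(b)] -/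
theorem hasMultiplicativeReductionAt_iff_of_under_eq [NumberField F] [IsGalois F E] [W.IsElliptic]
    (hW : ∀ σ : E ≃ₐ[F] E, ∃ C : VariableChange E, C • W = W.map (σ : E →+* E))
    {w w' : HeightOneSpectrum (𝓞 E)} (h : w.under (𝓞 F) = w'.under (𝓞 F)) :
    W.HasMultiplicativeReductionAt w ↔ W.HasMultiplicativeReductionAt w' := by
  obtain ⟨σ, rfl⟩ := HeightOneSpectrum.exists_algEquiv_smul_eq F h
  obtain ⟨C, hC⟩ := hW σ
  exact (hasMultiplicativeReductionAt_algEquiv_smul_iff_of_smul_eq_map σ w W hC).symm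

/-- **Constancy on fibres, additive reduction** (same hypotheses).
[cite: CasselsFrohlichANT1967, Ch. VII Prop. 1.2 (ii)] [cite: SilvermanAEC2009, VII.5 Prop. 5.1(c)] -/
theorem hasAdditiveReductionAt_iff_of_under_eq [NumberField F] [IsGalois F E] [W.IsElliptic]
    (hW : ∀ σ : E ≃ₐ[F] E, ∃ C : VariableChange E, C • W = W.map (σ : E →+* E))
    {w w' : HeightOneSpectrum (𝓞 E)} (h : w.under (𝓞 F) = w'.under (𝓞 F)) :
    W.HasAdditiveReductionAt w ↔ W.HasAdditiveReductionAt w' := by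
  obtain ⟨σ, rfl⟩ := HeightOneSpectrum.exists_algEquiv_smul_eq F h
  obtain ⟨C, hC⟩ := hW σ
  exact (hasAdditiveReductionAt_algEquiv_smul_iff_of_smul_eq_map σ w W hC).symm

end NumberField

end WeierstrassCurve

end
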